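import Mathlib
import HarnessLib
import Summits.PneNP.PneNP.Theses.RamseyUncertifiable
import Literature.Combinatorics.SimpleGraph.LovaszTheta
import Literature.Combinatorics.SimpleGraph.LovaszThetaComplement
import Literature.Combinatorics.SimpleGraph.LasserreStableBound

/-!
# Sketch — crux-ideate stmt-PneNP-9815 (SosUncertainty), round 1, ideator 1 (gen 2)

First-lemma signatures for two idea cards and one landscape note:

* Card `gm-centre-canonical-pair`: the geometric-mean Lasserre value `gmLasserre`, the sandwich
  `0 ≤ gm_t ≤ las_t`, GM-uncertainty `GmUncertainty`, the proved reduction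
  `sosUncertainty_of_gm`, the level-1 target `GmUncertaintyOne`, and the KKT statement
  `CanonicalPair` (log-barrier centre + complementary certificate with exact normalisation `n`).
* Card `one-flip-heredity`: `LopsidedUP`, `TwoSidedRichUP`, the one-flip lemma `OneFlip`
  (from induced-subgraph monotonicity of `ϑ` + Lovász Cor. 2) and the dichotomy reduction
  `DichotomyReduction`.
* Note `two-field-anatomy`: Haemers' fitting matrices `Fits`, `minrank`, and the single-field
  rank uncertainty principle `RankUncertainty`.
-/

namespace Summit.PneNP.PneNP.Cruxes.SosUncertainty.Ideator1g2

open Literature.Combinatorics.SimpleGraph Finset Matrix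
open Summit.PneNP.PneNP.Theses.RamseyUncertifiable (SosUncertainty)

noncomputable section

/-! ## Card A — geometric-mean centre and the canonical KKT pair -/

variable {V : Type*} [Fintype V] [DecidableEq V]

/-- The geometric-mean value of a level-`t` moment sequence: `n · (∏_v y_v)^{1/n}` (so that by
AM–GM it is at most `Σ_v y_v`). -/
def gmValue (y : Finset V → ℝ) : ℝ :=
  (Fintype.card V : ℝ) * (∏ v, y {v}) ^ ((Fintype.card V : ℝ)⁻¹)

/-- The **geometric-mean Lasserre value** `gm_t(G)`: the supremum of `n (∏_v y_v)^{1/n}` over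
level-`t` feasible `y` (Laurent's program (22)). Its maximiser is the log-barrier / analytic
centre of the level-`t` theta body in the singleton coordinates. -/
def gmLasserre (G : SimpleGraph V) (t : ℕ) : ℝ :=
  sSup (gmValue '' {y | IsLasserreFeasible G t y})

/-- Sandwich `0 ≤ gm_t(G) ≤ las_t(G)` for `t ≥ 1` (AM–GM on `0 ≤ y_v`; provable now, S). -/
def GmSandwich : Prop :=
  ∀ (n t : ℕ), 1 ≤ t → ∀ G : SimpleGraph (Fin n),
    0 ≤ gmLasserre G t ∧ gmLasserre G t ≤ lasserreStableBound G t

/-- **GM-uncertainty at level `t`** (the card's C⁺): `gm_t(G) · gm_t(Ḡ) ≥ n^δ`. -/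
def GmUncertainty : Prop :=
  ∀ t : ℕ, 1 ≤ t → ∃ δ : ℝ, 0 < δ ∧ ∃ n₀ : ℕ, ∀ n ≥ n₀, ∀ G : SimpleGraph (Fin n),
    (n : ℝ) ^ δ ≤ gmLasserre G t * gmLasserre Gᶜ t

/-- The reduction `GmSandwich → GmUncertainty → SosUncertainty` (pure inequalities). -/
theorem sosUncertainty_of_gm (hs : GmSandwich) (hg : GmUncertainty) : SosUncertainty := by
  intro t ht
  obtain ⟨δ, hδ, n₀, h⟩ := hg t ht
  refine ⟨δ, hδ, n₀, fun n hn G => ?_⟩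
  have h1 := h n hn G
  obtain ⟨h0G, hleG⟩ := hs n t ht G
  obtain ⟨h0Gc, hleGc⟩ := hs n t ht Gᶜ
  calc (n : ℝ) ^ δ ≤ gmLasserre G t * gmLasserre Gᶜ t := h1
    _ ≤ lasserreStableBound G t * lasserreStableBound Gᶜ t :=
        mul_le_mul hleG hleGc h0Gc (h0G.trans hleG)

/-- **Level-1 GM-uncertainty** (first real target of the card, Lovász's Corollary 2 in
geometric-mean form): `gm_1(G) · gm_1(Ḡ) ≥ n`. Proof route: the GM-maximiser `y*` of the
(compact, convex) level-1 body satisfies `Σ_v y_v / y*_v ≤ n` for every feasible `y`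
(first-order optimality of `Σ log`), i.e. `z* := (1/(n y*_v))_v` lies in the antiblocker of the
theta body `TH(G)`, which is `TH(Ḡ)` (Grötschel–Lovász–Schrijver); `gm(z*) · gm(y*) = 1/… ` gives
the claim with no SDP duality beyond `TH(G)^abl = TH(Ḡ)`. -/
def GmUncertaintyOne : Prop :=
  ∀ n : ℕ, 1 ≤ n → ∀ G : SimpleGraph (Fin n), (n : ℝ) ≤ gmLasserre G 1 * gmLasserre Gᶜ 1

/-- Shadow of a matrix indexed by `P_t(V)` on a subset `S`: `Σ_{I ∪ J = S} Λ_{I,J}` — the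
coefficient of the multilinear monomial `x_S` in the Gram form `mᵀ Λ m` of the monomial vector
`m = (x_I)_{|I| ≤ t}` modulo `x_v² = x_v`. -/
def shadow (t : ℕ) (Λ : Matrix {S : Finset V // S.card ≤ t} {S : Finset V // S.card ≤ t} ℝ)
    (S : Finset V) : ℝ :=
  ∑ I, ∑ J, if I.1 ∪ J.1 = S then Λ I J else 0

/-- **Canonical primal–dual pair at level `t`** (KKT for `max Σ_v log y_v` over Laurent's
program (22)): there is a level-`t` feasible `y` with all `y_v > 0` maximising `∏_v y_v`, and a
PSD certificate `Λ` on `P_t(V)` which is complementary to `M_t(y)` (`Λ · M_t(y) = 0`) and whose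
shadows are: `n` on `∅`, `-1/y_v` on singletons, `0` on every stable `S` with `2 ≤ |S| ≤ 2t`
(free on non-stable `S`). I.e. `Λ` is a degree-`2t` SoS certificate of `Σ_v x_v / y_v ≤ n` on
stable sets, with EXACT normalisation `n` (= `⟨Λ, M_t(y)⟩ = 0` read on shadows). Existence:
compactness of the feasible set (`t ≥ 1`), Slater fails only in the lineality directions handled
by restricting to the face; stated here as the card's structural lemma (M). -/
def CanonicalPair (t : ℕ) : Prop :=
  ∀ (n : ℕ), 1 ≤ n → ∀ G : SimpleGraph (Fin n),
    ∃ y : Finset (Fin n) → ℝ, IsLasserreFeasible G t y ∧ (∀ v, 0 < y {v}) ∧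
      (∀ y', IsLasserreFeasible G t y' → ∏ v, y' {v} ≤ ∏ v, y {v}) ∧
      ∃ Λ : Matrix {S : Finset (Fin n) // S.card ≤ t} {S : Finset (Fin n) // S.card ≤ t} ℝ,
        Λ.PosSemidef ∧ Λ * momentMatrix t y = 0 ∧
        shadow t Λ ∅ = n ∧ (∀ v, shadow t Λ {v} = -(y {v})⁻¹) ∧
        ∀ S : Finset (Fin n), 2 ≤ S.card → S.card ≤ 2 * t → G.IsIndepSet (S : Set (Fin n)) →
          shadow t Λ S = 0

/-- **Mixed-mass clearing** (the card's crux-side conjecture MC_t, stated at the level of values):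
from the canonical pair one can produce level-`t` moments for `Ḡ` (supported on cliques of `G`)
of geometric-mean value `≥ n^δ / gm_t(G)`; equivalently `GmUncertainty`. Recorded as the target
the flip must reach; the quantitative content is in the card (shadow mass of `Λ` on MIXED sets —
sets containing both an edge and a non-edge — must be cleared at multiplicative cost `n^{1-δ}`). -/
def MixedMassClearing (t : ℕ) : Prop :=
  ∃ δ : ℝ, 0 < δ ∧ ∃ n₀ : ℕ, ∀ n ≥ n₀, ∀ G : SimpleGraph (Fin n),
    (n : ℝ) ^ δ ≤ gmLasserre G t * gmLasserre Gᶜ t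

/-! ## Card B — one flip by heredity of theta-poverty -/

/-- `ϑ` is monotone under induced subgraphs (zero-padding of a feasible `B`; proved in the
disprover's Disproof.lean v4 as `lovaszTheta_comap_le`, not yet in the tree). -/
def ThetaInduceMono : Prop :=
  ∀ (n : ℕ) (G : SimpleGraph (Fin n)) (L L' : Finset (Fin n)), L' ⊆ L →
    lovaszTheta (G.induce (L' : Set (Fin n))) ≤ lovaszTheta (G.induce (L : Set (Fin n)))

/-- **One flip.** If an arena `L` is theta-poor for `G` (`ϑ(G[L]) ≤ M`) then on EVERY
sub-arena `L' ⊆ L` the complement is theta-rich with the absolute scale `|L'|/M`: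
`|L'| ≤ M · ϑ(Ḡ[L'])`. (Monotonicity + Lovász Cor. 2 on `L'`; provable now given
`ThetaInduceMono`, S.) Consequence: along any conditioning descent the theta-rich side changes
at most once, and after the change richness is hereditary with exponent `→ 1`. -/
def OneFlip : Prop :=
  ∀ (n : ℕ) (G : SimpleGraph (Fin n)) (L L' : Finset (Fin n)) (M : ℝ), L' ⊆ L → L'.Nonempty →
    lovaszTheta (G.induce (L : Set (Fin n))) ≤ M →
      (L'.card : ℝ) ≤ M * lovaszTheta (Gᶜ.induce (L' : Set (Fin n)))

/-- `OneFlip` from monotonicity and Lovász's Corollary 2 (the latter is the tree theorem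
`card_le_lovaszTheta_mul_lovaszTheta_compl`). -/
theorem oneFlip_of_mono (hmono : ThetaInduceMono) : OneFlip := by
  intro n G L L' M hsub hne hpoor
  have hne' : Nonempty ((L' : Set (Fin n)) : Type) := by
    obtain ⟨v, hv⟩ := hne
    exact ⟨⟨v, by exact_mod_cast hv⟩⟩
  have hcor := card_le_lovaszTheta_mul_lovaszTheta_compl (G.induce (L' : Set (Fin n)))
  have hcard : (Fintype.card ((L' : Set (Fin n)) : Type) : ℝ) = L'.card := by
    have : Fintype.card ((L' : Set (Fin n)) : Type) = L'.card := by
      rw [← Set.toFinset_card, Finset.toFinset_coe]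
    exact_mod_cast this
  have hcompl : (G.induce (L' : Set (Fin n)))ᶜ = Gᶜ.induce (L' : Set (Fin n)) := by
    ext a b
    simp only [SimpleGraph.compl_adj, SimpleGraph.induce_adj, ne_eq, Subtype.ext_iff]
  have hmono' := hmono n G L L' hsub
  have hθpos : 0 ≤ lovaszTheta (Gᶜ.induce (L' : Set (Fin n))) :=
    zero_le_one.trans (one_le_lovaszTheta _)
  rw [hcard, hcompl] at hcor
  calc (L'.card : ℝ) ≤ lovaszTheta (G.induce (L' : Set (Fin n))) *
        lovaszTheta (Gᶜ.induce (L' : Set (Fin n))) := hcor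
    _ ≤ M * lovaszTheta (Gᶜ.induce (L' : Set (Fin n))) :=
        mul_le_mul_of_nonneg_right (hmono'.trans hpoor) hθpos

/-- **Lopsided rung** `LopsidedUP_t` (the minimal open special case of UP_t isolated by the
flip): if degree 2 already certifies the clique side, `ϑ(Ḡ) ≤ n^ε`, then no constant level
certifies the stable side: `las_t(G) ≥ n^δ`. (Level `t = 1` is Lovász with `δ = 1 - ε`.) -/
def LopsidedUP (t : ℕ) : Prop :=
  ∃ ε : ℝ, 0 < ε ∧ ∃ δ : ℝ, 0 < δ ∧ ∃ n₀ : ℕ, ∀ n ≥ n₀, ∀ G : SimpleGraph (Fin n),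
    lovaszTheta Gᶜ ≤ (n : ℝ) ^ ε → (n : ℝ) ^ δ ≤ lasserreStableBound G t

/-- **Two-sided hereditarily theta-rich graphs satisfy UP_t** (`TwoSidedRichUP_t`, the generic
branch): if EVERY induced subgraph on `≥ n^γ` vertices has `ϑ > (size)^ε` on both sides — the
Feige–Krauthgamer hypothesis on every conditioning leaf of both sides, for free — then
`las_t(G) las_t(Ḡ) ≥ n^δ`. -/
def TwoSidedRichUP (t : ℕ) : Prop :=
  ∀ γ ε : ℝ, 0 < γ → γ < 1 → 0 < ε → ∃ δ : ℝ, 0 < δ ∧ ∃ n₀ : ℕ, ∀ n ≥ n₀,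
    ∀ G : SimpleGraph (Fin n),
      (∀ L : Finset (Fin n), (n : ℝ) ^ γ ≤ L.card →
        (L.card : ℝ) ^ ε < lovaszTheta (G.induce (L : Set (Fin n))) ∧
        (L.card : ℝ) ^ ε < lovaszTheta (Gᶜ.induce (L : Set (Fin n)))) →
      (n : ℝ) ^ δ ≤ lasserreStableBound G t * lasserreStableBound Gᶜ t

/-- Monotonicity of `las_t` under induced subgraphs (zero-extension of a feasible `y`;
provable now, S). -/
def LasInduceMono : Prop :=
  ∀ (n t : ℕ), 1 ≤ t → ∀ (G : SimpleGraph (Fin n)) (L : Finset (Fin n)),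
    lasserreStableBound (G.induce (L : Set (Fin n))) t ≤ lasserreStableBound G t

/-- **Dichotomy reduction** (the card's assembly of the crux from its two branches; logic +
`OneFlip` + `LasInduceMono` + `1 ≤ las_t`; provable now modulo real-exponent bookkeeping, S/M):
`(∀ t ≥ 1, LopsidedUP t) → (∀ t ≥ 1, TwoSidedRichUP t) → SosUncertainty`. -/
def DichotomyReduction : Prop :=
  (∀ t, 1 ≤ t → LopsidedUP t) → (∀ t, 1 ≤ t → TwoSidedRichUP t) → SosUncertainty

/-! ## Note — Haemers' fitting matrices: rank uncertainty over ONE field -/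

/-- A matrix over a field `K` **fits** `G` (Haemers 1979): nonzero diagonal, zero on distinct
non-adjacent pairs. Independent sets give invertible diagonal principal submatrices, so
`α(G) ≤ rank M`. -/
def Fits {K : Type*} [Field K] (G : SimpleGraph V) (M : Matrix V V K) : Prop :=
  (∀ v, M v v ≠ 0) ∧ ∀ u v, u ≠ v → ¬ G.Adj u v → M u v = 0

/-- Haemers' minimum rank of `G` over `K`. -/
def minrank (K : Type*) [Field K] (G : SimpleGraph V) : ℕ :=
  sInf {r | ∃ M : Matrix V V K, Fits G M ∧ M.rank = r}

/-- **Haemers' bound** `α(G) ≤ minrank_K(G)` (provable now, S). -/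
def HaemersBound : Prop :=
  ∀ (K : Type) [Field K] (n : ℕ) (G : SimpleGraph (Fin n)), G.indepNum ≤ minrank K G

/-- **Single-field rank uncertainty**: `minrank_K(G) · minrank_K(Ḡ) ≥ n` for EVERY field `K`
(if `M` fits `G` and `M'` fits `Ḡ` then `M ∘ M'` is diagonal with nonzero diagonal, a principal
submatrix of `M ⊗ M'`, so `n = rank (M ∘ M') ≤ rank M · rank M'`; provable now, M). The
explicit subpolynomial Ramsey families (Frankl–Wilson, Grolmusz, Alon's union graphs) are
rank-certified on their two sides over fields of DIFFERENT characteristic — the only way to evade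
this inequality. -/
def RankUncertainty : Prop :=
  ∀ (K : Type) [Field K] (n : ℕ) (G : SimpleGraph (Fin n)), n ≤ minrank K G * minrank K Gᶜ

end

end Summit.PneNP.PneNP.Cruxes.SosUncertainty.Ideator1g2

/-- The GM reduction concludes the crux by name. -/
example (hs : Summit.PneNP.PneNP.Cruxes.SosUncertainty.Ideator1g2.GmSandwich)
    (hg : Summit.PneNP.PneNP.Cruxes.SosUncertainty.Ideator1g2.GmUncertainty) :
    Summit.PneNP.PneNP.Theses.RamseyUncertifiable.SosUncertainty :=
  Summit.PneNP.PneNP.Cruxes.SosUncertainty.Ideator1g2.sosUncertainty_of_gm hs hg
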